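/-
Copyright (c) 2026 the pub-hodgecm-mathlib formalisation cell (harness21).  Prover seat hodgecm-mathlib-LH4-p07 (g6), req620 Track A «(D-RAM) FOUR-FRAME» squad
(unit U2H_HSide, the (ρ2b′-X) road of `Cruxes/H413/Lines/F0_P3c_DyRamFourFrame_U2H_HSide.lean` :418; payer of record LH4-p14 (g3) ORDER v1 b16823cc, organ O-Glue ∕ O-Ax,
dealt 2026-09-04T04:08Z «T6-side lemma GLUE FIBRATION»; dealer LH4-plan (g12) WORD #21).  2026-09-04.
-/
import Literature.NumberTheory.Automorphic.UnitaryLatticeTreeTubeCoordinate     -- ★ (F0P2-p01 (g16)): `exists_tubeCoordinate`, `tubeCoordinate_unique` — the tube coordinate of a self-dual lattice for a block form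
import HarnessLib

/-!
# The lattice graph of a hermitian space — THE GLUE FIBRATION: a finite family of self-dual lattices for a BLOCK form is partitioned by (tube coordinate, `W`-part)
# (Bruhat–Tits 1972 §10; Kottwitz 1986 §1; Jacobowitz 1962 §4; Serre, *Trees* II.1.1)

Topic `NumberTheory/Automorphic`; namespace `Literature.NumberTheory.Automorphic.UnitaryLatticeTree`.  THEOREMS ONLY (no definition, no instance, no notation, no named fact,
no `sorry`); kernel lane `--supports stmt-HodgeConjecture-24833`; DATUM-FREE (`K` with `Valued K ℤᵐ⁰`, `σ` valuation-preserving, `|ϖ| = exp(−1)`; no PID, no `|2| = 1`,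
no residue-field hypothesis).  Cell `pub/hodgecm-mathlib`, crux H413 = `stmt-HodgeConjecture-24833`; squad F0∕P3c∕LH4 «(D-RAM) FOUR-FRAME», the WILD type-(2) G-side census
(ρ2b′-X) `stub_U2H_fixedPointCensus_typeTwo_unit0` (U2H ED. 15 :418): payer LH4-p14 (g3) ORDER v1 organs O-Ax∕O-Glue (`N(t) = Σ_{b ≥ 0} Σ_{B} #{M : tube b, W-part B}`),
consumed by the HEAD-of-organs `Theorems/F0P3cDyRamFixedPointCensusTypeTwoOfOrgans` together with ★ T2a∕T2b∕T2c (`UnitaryLatticeTreeBlockGlueFibre{,Count,Fixed}`).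
HONEST LABEL: HC_CM is proved only modulo the 7 printed citations (2 remaining named inputs: hLiu418 = stmt-HodgeConjecture-24832, h413 = stmt-HodgeConjecture-24833) until rung 0
closes; elementary finite-set bookkeeping over the ★ tube coordinate, no census content, no books consequence.

THE MATHEMATICS (block currency of ★ `UnitaryLatticeTreeTubeCoordinate`: `V = K³ = W ⊕ Ke₁`, `W = {x | x₁ = 0} = ker pr₁`, form `H = !![H₂ 0 0, 0, H₂ 0 1; 0, h, 0; H₂ 1 0,
0, H₂ 1 1]`, `det H₂` a unit, `|h| = 1`).  Every SELF-DUAL lattice `M` has a unique TUBE COORDINATE `b(M) : ℕ` (`c·e₁ ∈ M ⟺ |c| ≤ |ϖ|^b`, ★ (c1-i) `exists_tubeCoordinate`, (c1-i′)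
`tubeCoordinate_unique`), and `b(M) = 0 ⟺ e₁ ∈ M` (the AXIS).  Hence ANY FINITE family `F = {M self-dual | P M}` (for instance `P M := (Γ·M = M)`, the fixed set of a block
element, finite by ★ `UnitaryLatticeTreeBlockFixedFinite` ∕ `…BlockTubeBoundFixedFinite`) whose tube coordinates are bounded by `R` is the DISJOINT union over `b ∈ [0, R]` of
its tube layers, the layer `b = 0` is `{M ∈ F | e₁ ∈ M}`, and each layer `b ≥ 1` is the disjoint union over `B` of the GLUE FIBRES `{M ∈ F | b(M) = b, M ∩ W = B}`:
`#F = #{M ∈ F | e₁ ∈ M} + Σ_{b=1}^{R} Σᶠ_B #{M ∈ F | b(M) = b ∧ M ∩ W = B}` — the `Σᶠ_B` running over all `W`-submodules (only finitely many fibres are non-empty).  §0 is the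
generic finite-set regrouping (`Finset.card_eq_sum_card_fiberwise` in `Set.ncard`∕`finsum` currency); §1 the fibration for an arbitrary predicate `P`; §2 the instance
`P M := (mapGL Γ M = M)` in the letters of the (ρ2b′-X) HEAD (LH4-p14 (g3) 04:08Z).  With ★ T2b `ncard_glueFibre_eq_natCard_normFibre` each fibre with `b ≥ 1` is a norm-residue
count `#Sol_{2b}(r_B)`, so the census of `F` reduces to the `W`-side (O-W∕O-Cone) and the axis (b = 0).

## References
* [BruhatTits1972] F. Bruhat, J. Tits, *Groupes réductifs sur un corps local I*, Publ. Math. IHÉS 41 (1972), §10 (lattice models of the rank-one building; tube layers).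
* [Kottwitz1986BaseChangeUnits] R. E. Kottwitz, *Base change for unit elements of Hecke algebras*, Compositio Math. 60 (1986), §1 pp. 240–241 (orbital integrals of units as
  fixed-lattice counts).
* [Jacobowitz1962] R. Jacobowitz, *Hermitian forms over local fields*, Amer. J. Math. 84 (1962), §4 (dual lattices, gluing of modular components).
* [Serre1980Trees] J.-P. Serre, *Trees* (1980), Ch. II §1.1 (lattices, distance from a base lattice).
-/

set_option autoImplicit false

noncomputable section

open scoped Valued WithZero Matrix MatrixGroups

namespace Literature.NumberTheory.Automorphic.UnitaryLatticeTree

open Literature.NumberTheory.Automorphic Literature.NumberTheory.Automorphic.HermitianLattice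

/-! ## §0 Finite-set regrouping in `Set.ncard` ∕ `finsum` currency -/

section Regroup

variable {α β : Type*}

/-- **REGROUPING A FINITE SET BY A KEY WITH VALUES IN A FINSET**: `#s = Σ_{y ∈ t} #{x ∈ s | g x = y}` whenever `g(s) ⊆ t` (`Finset.card_eq_sum_card_fiberwise` in `Set.ncard`
currency). [cite: Serre1980Trees, Ch. II §1.1] -/
theorem ncard_eq_sum_ncard_fiber_of_mapsTo (s : Set α) (hs : s.Finite) (g : α → β) (t : Finset β) (ht : ∀ x ∈ s, g x ∈ t) :
    s.ncard = ∑ y ∈ t, {x | x ∈ s ∧ g x = y}.ncard := by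
  classical
  rw [Set.ncard_eq_toFinset_card s hs, Finset.card_eq_sum_card_fiberwise (f := g) (t := t) (fun x hx => ht x ((Set.Finite.mem_toFinset hs).1 hx))]
  refine Finset.sum_congr rfl (fun y _ => ?_)
  rw [← Set.ncard_coe_finset]
  congr 1
  ext x
  simp [Set.Finite.mem_toFinset]

/-- **REGROUPING A FINITE SET BY AN ARBITRARY KEY**: `#s = Σᶠ_y #{x ∈ s | g x = y}` — the `finsum` over ALL `y`, only finitely many fibres being non-empty.
[cite: Serre1980Trees, Ch. II §1.1] -/
theorem ncard_eq_finsum_ncard_fiber (s : Set α) (hs : s.Finite) (g : α → β) :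
    s.ncard = ∑ᶠ y : β, {x | x ∈ s ∧ g x = y}.ncard := by
  classical
  have hsupp : (Function.support fun y : β => {x | x ∈ s ∧ g x = y}.ncard) ⊆ ((hs.toFinset.image g : Finset β) : Set β) := by
    intro y hy
    rw [Function.mem_support] at hy
    obtain ⟨x, hx⟩ := Set.nonempty_of_ncard_ne_zero hy
    rw [Finset.coe_image, Set.mem_image]
    exact ⟨x, (Set.Finite.mem_toFinset hs).2 hx.1, hx.2⟩
  rw [finsum_eq_sum_of_support_subset _ hsupp]
  exact ncard_eq_sum_ncard_fiber_of_mapsTo s hs g _ (fun x hx => Finset.mem_image_of_mem g ((Set.Finite.mem_toFinset hs).2 hx))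

end Regroup

variable {K : Type*} [Field K] [Valued K ℤᵐ⁰]

/-! ## §1 The glue fibration of a finite family of self-dual lattices (block form, arbitrary side condition `P`) -/

/-- **THE GLUE FIBRATION (general side condition).**  Block form `H = !![H₂ 0 0, 0, H₂ 0 1; 0, h, 0; H₂ 1 0, 0, H₂ 1 1]` (`det H₂` a unit, `|h| = 1`), `σ` valuation-preserving,
`|ϖ| = exp(−1)`; `P` ANY predicate on lattices.  If the family `F = {M | M self-dual ∧ P M}` is FINITE and every tube coordinate in it is `≤ R`, then
`#F = #{M ∈ F | e₁ ∈ M} + Σ_{b ∈ [1, R]} Σᶠ_B #{M ∈ F | (c·e₁ ∈ M ⟺ |c| ≤ |ϖ|^b) ∧ M ∩ W = B}` (`W = ker pr₁`): the partition of `F` by (tube coordinate, `W`-part), the layer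
`b = 0` being the AXIS `e₁ ∈ M` (★ `tubeCoordinate_unique`.2).  Pure regrouping over ★ `exists_tubeCoordinate` ∕ `tubeCoordinate_unique`; no census content.
[cite: BruhatTits1972, §10] [cite: Jacobowitz1962, §4] [cite: Kottwitz1986BaseChangeUnits, §1 pp. 240–241] -/
theorem ncard_selfDual_eq_ncard_axis_add_sum_finsum_ncard_glueFibre (σ : K →+* K) (hvσ : ∀ a, Valued.v (σ a) = Valued.v a)
    {ϖ : K} (hϖ : Valued.v ϖ = WithZero.exp (-1 : ℤ))
    {H₂ : Matrix (Fin 2) (Fin 2) K} (hH₂ : IsUnit H₂.det) {h : K} (hh : Valued.v h = 1)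
    (P : Submodule 𝒪[K] (Fin 3 → K) → Prop) {R : ℕ}
    (hfin : {M : Submodule 𝒪[K] (Fin 3 → K) |
      IsSelfDualLattice σ ϖ (!![H₂ 0 0, 0, H₂ 0 1; 0, h, 0; H₂ 1 0, 0, H₂ 1 1] : Matrix (Fin 3) (Fin 3) K) M ∧ P M}.Finite)
    (hR : ∀ M : Submodule 𝒪[K] (Fin 3 → K), IsSelfDualLattice σ ϖ (!![H₂ 0 0, 0, H₂ 0 1; 0, h, 0; H₂ 1 0, 0, H₂ 1 1] : Matrix (Fin 3) (Fin 3) K) M → P M →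
      ∀ b : ℕ, (∀ c : K, (Pi.single 1 c : Fin 3 → K) ∈ M ↔ Valued.v c ≤ Valued.v ϖ ^ b) → b ≤ R) :
    {M : Submodule 𝒪[K] (Fin 3 → K) |
        IsSelfDualLattice σ ϖ (!![H₂ 0 0, 0, H₂ 0 1; 0, h, 0; H₂ 1 0, 0, H₂ 1 1] : Matrix (Fin 3) (Fin 3) K) M ∧ P M}.ncard =
      {M : Submodule 𝒪[K] (Fin 3 → K) |
          (IsSelfDualLattice σ ϖ (!![H₂ 0 0, 0, H₂ 0 1; 0, h, 0; H₂ 1 0, 0, H₂ 1 1] : Matrix (Fin 3) (Fin 3) K) M ∧ P M) ∧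
            (Pi.single 1 1 : Fin 3 → K) ∈ M}.ncard +
        ∑ b ∈ Finset.Icc 1 R, ∑ᶠ B : Submodule 𝒪[K] (Fin 3 → K),
          {M : Submodule 𝒪[K] (Fin 3 → K) |
            (IsSelfDualLattice σ ϖ (!![H₂ 0 0, 0, H₂ 0 1; 0, h, 0; H₂ 1 0, 0, H₂ 1 1] : Matrix (Fin 3) (Fin 3) K) M ∧ P M) ∧
              (∀ c : K, (Pi.single 1 c : Fin 3 → K) ∈ M ↔ Valued.v c ≤ Valued.v ϖ ^ b) ∧
              M ⊓ LinearMap.ker ((LinearMap.proj (1 : Fin 3) : (Fin 3 → K) →ₗ[K] K).restrictScalars 𝒪[K]) = B}.ncard := by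
  classical
  set H : Matrix (Fin 3) (Fin 3) K := !![H₂ 0 0, 0, H₂ 0 1; 0, h, 0; H₂ 1 0, 0, H₂ 1 1] with hHdef
  set Wk : Submodule 𝒪[K] (Fin 3 → K) := LinearMap.ker ((LinearMap.proj (1 : Fin 3) : (Fin 3 → K) →ₗ[K] K).restrictScalars 𝒪[K]) with hWk
  set F : Set (Submodule 𝒪[K] (Fin 3 → K)) := {M | IsSelfDualLattice σ ϖ H M ∧ P M} with hF
  -- the tube coordinate as a function on `F` (★ (c1-i) existence; junk `0` off `F`, never read)
  have hex : ∀ M : Submodule 𝒪[K] (Fin 3 → K), ∃ b : ℕ, M ∈ F → ∀ c : K, (Pi.single 1 c : Fin 3 → K) ∈ M ↔ Valued.v c ≤ Valued.v ϖ ^ b := by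
    intro M
    by_cases hM : M ∈ F
    · obtain ⟨b, hb, -, -⟩ := exists_tubeCoordinate σ hvσ hϖ hH₂ hh hM.1
      exact ⟨b, fun _ => hb⟩
    · exact ⟨0, fun h' => (hM h').elim⟩
  choose tc htc using hex
  -- ★ (c1-i′): uniqueness, the axis `b = 0 ⟺ e₁ ∈ M`, and the bound
  have huniq : ∀ M ∈ F, ∀ b : ℕ, (∀ c : K, (Pi.single 1 c : Fin 3 → K) ∈ M ↔ Valued.v c ≤ Valued.v ϖ ^ b) → b = tc M :=
    fun M hM b hb => (tubeCoordinate_unique hϖ hb (htc M hM)).1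
  have haxis : ∀ M ∈ F, ((Pi.single 1 1 : Fin 3 → K) ∈ M ↔ tc M = 0) :=
    fun M hM => (tubeCoordinate_unique hϖ (htc M hM) (htc M hM)).2
  have hbound : ∀ M ∈ F, tc M ∈ Finset.Icc 0 R := fun M hM =>
    Finset.mem_Icc.2 ⟨Nat.zero_le _, hR M hM.1 hM.2 (tc M) (htc M hM)⟩
  -- (A) regroup `F` by the tube coordinate over `[0, R]`, and split off the axis layer `b = 0`
  have hIcc : Finset.Icc 0 R = insert 0 (Finset.Icc 1 R) := by
    ext b
    simp only [Finset.mem_Icc, Finset.mem_insert]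
    omega
  rw [ncard_eq_sum_ncard_fiber_of_mapsTo F hfin tc (Finset.Icc 0 R) hbound, hIcc, Finset.sum_insert (by simp)]
  congr 1
  · -- the axis layer: `tc M = 0 ⟺ e₁ ∈ M`
    congr 1
    ext M
    simp only [Set.mem_setOf_eq]
    constructor
    · rintro ⟨hM, h0⟩
      exact ⟨hM, (haxis M hM).2 h0⟩
    · rintro ⟨hM, he⟩
      exact ⟨hM, (haxis M hM).1 he⟩
  · -- the tube layers `b ≥ 1`, each regrouped by the `W`-part `M ⊓ W`
    refine Finset.sum_congr rfl (fun b _ => ?_)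
    have hlayer : {M : Submodule 𝒪[K] (Fin 3 → K) | M ∈ F ∧ tc M = b} =
        {M | M ∈ F ∧ ∀ c : K, (Pi.single 1 c : Fin 3 → K) ∈ M ↔ Valued.v c ≤ Valued.v ϖ ^ b} := by
      ext M
      simp only [Set.mem_setOf_eq]
      constructor
      · rintro ⟨hM, hb⟩
        exact ⟨hM, hb ▸ htc M hM⟩
      · rintro ⟨hM, hb⟩
        exact ⟨hM, (huniq M hM b hb).symm⟩
    rw [hlayer, ncard_eq_finsum_ncard_fiber _ (hfin.subset (fun M hM => hM.1)) (fun M => M ⊓ Wk)]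
    refine finsum_congr (fun B => ?_)
    congr 1
    ext M
    simp only [hF, Set.mem_setOf_eq, and_assoc]

/-! ## §2 The instance of the (ρ2b′-X) HEAD: the fixed set of a lattice automorphism `Γ` -/

/-- **THE GLUE FIBRATION OF A FIXED SET.**  Same block form; `Γ : GL₃(K)` ARBITRARY.  If the fixed self-dual family `F = {M self-dual | Γ·M = M}` is finite (★
`UnitaryLatticeTreeBlockFixedFinite` ∕ `…BlockTubeBoundFixedFinite` for block elements) with tube coordinates `≤ R` (★ `tubeCoordinate_le_of_v_det_eq`), then
`#F = #{M ∈ F | e₁ ∈ M} + Σ_{b=1}^{R} Σᶠ_B #{M ∈ F | (c·e₁ ∈ M ⟺ |c| ≤ |ϖ|^b) ∧ M ∩ W = B}` — the O-Ax∕O-Glue decomposition `N(t) = #axis + Σ_{b ≥ 1} Σ_B #glue(B, b)` of the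
(ρ2b′-X) payer (LH4-p14 (g3) ORDER v1), each glue fibre being counted by ★ T2b `ncard_glueFibre_eq_natCard_normFibre`.
[cite: BruhatTits1972, §10] [cite: Kottwitz1986BaseChangeUnits, §1 pp. 240–241] [cite: Jacobowitz1962, §4] -/
theorem ncard_fixed_selfDual_eq_ncard_axis_add_sum_finsum_ncard_glueFibre (σ : K →+* K) (hvσ : ∀ a, Valued.v (σ a) = Valued.v a)
    {ϖ : K} (hϖ : Valued.v ϖ = WithZero.exp (-1 : ℤ))
    {H₂ : Matrix (Fin 2) (Fin 2) K} (hH₂ : IsUnit H₂.det) {h : K} (hh : Valued.v h = 1)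
    (Γ : GL (Fin 3) K) {R : ℕ}
    (hfin : {M : Submodule 𝒪[K] (Fin 3 → K) |
      IsSelfDualLattice σ ϖ (!![H₂ 0 0, 0, H₂ 0 1; 0, h, 0; H₂ 1 0, 0, H₂ 1 1] : Matrix (Fin 3) (Fin 3) K) M ∧ mapGL Γ M = M}.Finite)
    (hR : ∀ M : Submodule 𝒪[K] (Fin 3 → K), IsSelfDualLattice σ ϖ (!![H₂ 0 0, 0, H₂ 0 1; 0, h, 0; H₂ 1 0, 0, H₂ 1 1] : Matrix (Fin 3) (Fin 3) K) M → mapGL Γ M = M →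
      ∀ b : ℕ, (∀ c : K, (Pi.single 1 c : Fin 3 → K) ∈ M ↔ Valued.v c ≤ Valued.v ϖ ^ b) → b ≤ R) :
    {M : Submodule 𝒪[K] (Fin 3 → K) |
        IsSelfDualLattice σ ϖ (!![H₂ 0 0, 0, H₂ 0 1; 0, h, 0; H₂ 1 0, 0, H₂ 1 1] : Matrix (Fin 3) (Fin 3) K) M ∧ mapGL Γ M = M}.ncard =
      {M : Submodule 𝒪[K] (Fin 3 → K) |
          (IsSelfDualLattice σ ϖ (!![H₂ 0 0, 0, H₂ 0 1; 0, h, 0; H₂ 1 0, 0, H₂ 1 1] : Matrix (Fin 3) (Fin 3) K) M ∧ mapGL Γ M = M) ∧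
            (Pi.single 1 1 : Fin 3 → K) ∈ M}.ncard +
        ∑ b ∈ Finset.Icc 1 R, ∑ᶠ B : Submodule 𝒪[K] (Fin 3 → K),
          {M : Submodule 𝒪[K] (Fin 3 → K) |
            (IsSelfDualLattice σ ϖ (!![H₂ 0 0, 0, H₂ 0 1; 0, h, 0; H₂ 1 0, 0, H₂ 1 1] : Matrix (Fin 3) (Fin 3) K) M ∧ mapGL Γ M = M) ∧
              (∀ c : K, (Pi.single 1 c : Fin 3 → K) ∈ M ↔ Valued.v c ≤ Valued.v ϖ ^ b) ∧
              M ⊓ LinearMap.ker ((LinearMap.proj (1 : Fin 3) : (Fin 3 → K) →ₗ[K] K).restrictScalars 𝒪[K]) = B}.ncard :=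
  ncard_selfDual_eq_ncard_axis_add_sum_finsum_ncard_glueFibre σ hvσ hϖ hH₂ hh (fun M => mapGL Γ M = M) hfin hR

end Literature.NumberTheory.Automorphic.UnitaryLatticeTree

end
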